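import Literature.Geometry.Kaehler.AnalyticSet
import Literature.Analysis.Complex.SeveralVariables
import Mathlib.Geometry.Manifold.MFDeriv.Atlas
import Mathlib.Geometry.Manifold.MFDeriv.FDeriv
import HarnessLib

/-!
# Regular points of analytic sets: chart calculus, stability, uniqueness of the codimension

Elementary differential-topological facts about the regular points of codimension `p`
(`Literature.Geometry.Kaehler.IsRegularPointOfCodim`) of a subset `Z` of a boundaryless complex manifold `M` (charted
space over a model with corners `I : ModelWithCorners ℂ E H`, `E` finite-dimensional,
`IsManifold I 1 M`), needed for the dimension theory of analytic sets ([Chirka1989, §2.3–2.4]):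

* `Literature.Geometry.Kaehler.mfderiv_eq_fderiv_comp_mfderiv_extChartAt`, `Literature.Geometry.Kaehler.surjective_mfderiv_iff_extChartAt`: in
  an extended chart `φ = extChartAt I x`, the manifold derivative of `f : M → F` at
  `y ∈ φ.source` is `D(f ∘ φ.symm)(φ y) ∘ Dφ(y)` with `Dφ(y)` invertible, so that surjectivity
  of `mfderiv f y` is read off the written function;
* `Literature.Geometry.Kaehler.SCV.ker_fderiv_le_ker_fderiv_of_forall_eq` (several complex variables, via the
  holomorphic straightening theorem `Literature.Analysis.Complex.SCV.exists_straightening`): if `F` and `G` are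
  holomorphic near `a`, `dF(a)` is surjective and `G` is constant on the fibre `{F = F a}` near
  `a`, then `ker dF(a) ≤ ker dG(a)`; hence two submersions with the same fibre through `a` have
  targets of the same dimension (`Literature.Geometry.Kaehler.SCV.finrank_eq_of_fderiv_surjective_of_forall_iff`);
* `Literature.Geometry.Kaehler.IsRegularPointOfCodim.eventually`: regularity of codimension `p` is an open condition
  (**stability**), [Chirka1989, §2.3, "reg A is open in A"];
* `Literature.Geometry.Kaehler.IsRegularPointOfCodim.codim_unique`: at a point of `Z`, the codimension of regularity is
  unique (**the dimension of `Z` at a regular point is well defined**), [Chirka1989, §2.3 Def.];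
* `Literature.Geometry.Kaehler.hasPureCodim_closure_of_isAnalyticSet_closure`: if the closure of the set of points of a
  closed `Z` that are regular of codimension `p` is analytic, it has pure codimension `p` (the
  elementary half of [Chirka1989, §5.2 Thm. 1]).

## References

* E. M. Chirka, *Complex Analytic Sets*, Kluwer (1989), §2.3 (regular points), A2.2 (implicit
  functions) [Chirka1989].
-/

open scoped Manifold ContDiff Topology
open Set Filter

namespace Literature.Geometry.Kaehler

variable {E : Type*} [NormedAddCommGroup E] [NormedSpace ℂ E]
  {H : Type*} [TopologicalSpace H] {I : ModelWithCorners ℂ E H}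
  {M : Type*} [TopologicalSpace M] [ChartedSpace H M]
  {F : Type*} [NormedAddCommGroup F] [NormedSpace ℂ F]

/-! ### Manifold derivative versus the derivative of the written function -/

section Chart

variable [IsManifold I 1 M]

/-- **Chain rule in an extended chart.** For `y` in the source of the extended chart
`φ = extChartAt I x` and `f : M → F` (a normed space) whose written function `f ∘ φ.symm` is
complex-differentiable at `φ y`, the manifold derivative of `f` at `y` is the composite of the
Fréchet derivative of the written function with the (invertible) derivative of the chart.
[folklore] -/
theorem mfderiv_eq_fderiv_comp_mfderiv_extChartAt {f : M → F} {x y : M}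
    (hy : y ∈ (extChartAt I x).source)
    (hF : DifferentiableAt ℂ (f ∘ (extChartAt I x).symm) (extChartAt I x y)) :
    mfderiv I 𝓘(ℂ, F) f y =
      (fderiv ℂ (f ∘ (extChartAt I x).symm) (extChartAt I x y)).comp
        (mfderiv I 𝓘(ℂ, E) (extChartAt I x) y) := by
  have hy' : y ∈ (chartAt H x).source := by rwa [← extChartAt_source (I := I)]
  have h1 : HasMFDerivAt 𝓘(ℂ, E) 𝓘(ℂ, F) (f ∘ (extChartAt I x).symm) (extChartAt I x y)
      (fderiv ℂ (f ∘ (extChartAt I x).symm) (extChartAt I x y)) :=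
    hasMFDerivAt_iff_hasFDerivAt.2 hF.hasFDerivAt
  have h2 : HasMFDerivAt I 𝓘(ℂ, E) (extChartAt I x) y
      (mfderiv I 𝓘(ℂ, E) (extChartAt I x) y) :=
    (mdifferentiableAt_extChartAt hy').hasMFDerivAt
  have h3 := h1.comp y h2
  have hev : f =ᶠ[𝓝 y] (f ∘ (extChartAt I x).symm) ∘ extChartAt I x := by
    filter_upwards [(isOpen_extChartAt_source (I := I) x).mem_nhds hy] with y' hy'
    simp only [Function.comp_apply, (extChartAt I x).left_inv hy']
  exact (h3.congr_of_eventuallyEq hev).mfderiv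

/-- In an extended chart `φ = extChartAt I x`, surjectivity of the manifold derivative of
`f : M → F` at `y ∈ φ.source` is equivalent to surjectivity of the Fréchet derivative of the
written function `f ∘ φ.symm` at `φ y` (the derivative of the chart is invertible,
`isInvertible_mfderiv_extChartAt`). [folklore] -/
theorem surjective_mfderiv_iff_extChartAt {f : M → F} {x y : M}
    (hy : y ∈ (extChartAt I x).source)
    (hF : DifferentiableAt ℂ (f ∘ (extChartAt I x).symm) (extChartAt I x y)) :
    Function.Surjective (mfderiv I 𝓘(ℂ, F) f y) ↔
      Function.Surjective (fderiv ℂ (f ∘ (extChartAt I x).symm) (extChartAt I x y)) := by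
  rw [mfderiv_eq_fderiv_comp_mfderiv_extChartAt hy hF]
  have hB := (isInvertible_mfderiv_extChartAt (I := I) hy).surjective
  constructor
  · intro h
    exact Function.Surjective.of_comp (g := mfderiv I 𝓘(ℂ, E) (extChartAt I x) y) h
  · intro h
    exact h.comp hB

/-- The written function of a map which is complex-differentiable (in the manifold sense) on a
set `U` is complex-differentiable, in the extended chart `φ = extChartAt I x`, on
`φ.target ∩ φ.symm ⁻¹' U` (an open set if `U` is open and `M` is boundaryless,
`isOpen_extChartAt_target_inter_preimage_symm`). [folklore] -/
theorem MDifferentiableOn.differentiableOn_extChartAt_symm {f : M → F} {U : Set M}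
    (hf : MDifferentiableOn I 𝓘(ℂ, F) f U) (x : M) :
    DifferentiableOn ℂ (f ∘ (extChartAt I x).symm)
      ((extChartAt I x).target ∩ (extChartAt I x).symm ⁻¹' U) := by
  have := (mdifferentiableOn_iff.1 hf).2 x 0
  simpa [mfld_simps] using this

end Chart

/-- On a boundaryless manifold, `φ.target ∩ φ.symm ⁻¹' U` is open for `φ = extChartAt I x` and
`U` open. [folklore] -/
theorem isOpen_extChartAt_target_inter_preimage_symm [I.Boundaryless] (x : M) {U : Set M}
    (hU : IsOpen U) : IsOpen ((extChartAt I x).target ∩ (extChartAt I x).symm ⁻¹' U) :=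
  (continuousOn_extChartAt_symm x).isOpen_inter_preimage (isOpen_extChartAt_target x) hU

/-! ### Kernels of differentials of holomorphic maps with a common fibre -/

namespace SCV

variable [FiniteDimensional ℂ E] {G : Type*} [NormedAddCommGroup G] [NormedSpace ℂ G]
  [FiniteDimensional ℂ G] {G' : Type*} [NormedAddCommGroup G'] [NormedSpace ℂ G']

/-- **Kernel comparison along a fibre.** Let `F : E → G` and `Gf : E → G'` be
complex-differentiable on an open set `W ∋ a` (finite-dimensional `E`, `G`), with `dF(a)`
surjective, and suppose `Gf` is constant on the fibre `{z ∈ W | F z = F a}`. Then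
`ker dF(a) ≤ ker dGf(a)`. Proof: by the holomorphic straightening theorem
(`exists_straightening`) the fibre is, near `a`, the biholomorphic image `Ψ ({F a} × K)` of an
open subset of `K = ker dF(a)`, on which `Gf ∘ Ψ` is constant; differentiate and use
`dΨ (0, ψ v) = v` for `v ∈ ker dF(a)`. [Chirka, *Complex Analytic Sets*, §2.3 and A2.2]
[folklore] -/
theorem ker_fderiv_le_ker_fderiv_of_forall_eq {F : E → G} {Gf : E → G'} {W : Set E}
    (hF : DifferentiableOn ℂ F W) (hGf : DifferentiableOn ℂ Gf W) (hW : IsOpen W) {a : E}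
    (ha : a ∈ W) (hsurj : Function.Surjective (fderiv ℂ F a))
    (hfib : ∀ z ∈ W, F z = F a → Gf z = Gf a) :
    LinearMap.ker (fderiv ℂ F a : E →ₗ[ℂ] G) ≤
      LinearMap.ker (fderiv ℂ Gf a : E →ₗ[ℂ] G') := by
  set K := LinearMap.ker (fderiv ℂ F a : E →ₗ[ℂ] G) with hK
  obtain ⟨ψ, hbij⟩ :
      ∃ ψ : E →L[ℂ] ↥K, Function.Bijective ((fderiv ℂ F a).prod ψ) :=
    Literature.Analysis.Complex.SCV.exists_proj_ker_bijective (fderiv ℂ F a) hsurj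
  obtain ⟨S, T, Ψ, hSo, haS, hSW, hTo, hΨd, hΦΨ, hΨΦ, -⟩ :=
    Literature.Analysis.Complex.SCV.exists_straightening hF hW ha ψ hbij
  intro v hv
  have hv0 : fderiv ℂ F a v = 0 := LinearMap.mem_ker.1 hv
  rw [LinearMap.mem_ker]
  have hψ0 : ψ (a - a) = 0 := by rw [sub_self, map_zero]
  -- `Φ a = (F a, 0)` lies in `T` and `Ψ (F a, 0) = a`
  have h0T : (F a, (0 : ↥K)) ∈ T := by
    have := (hΦΨ a haS).1
    rwa [hψ0] at this
  have hΨ0 : Ψ (F a, 0) = a := by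
    have := (hΦΨ a haS).2
    rwa [hψ0] at this
  -- the slice `ι k = (F a, k)` and the constant composite `Gf ∘ Ψ ∘ ι` near `0`
  set ι : ↥K → G × ↥K := fun k => (F a, k) with hι
  have hιc : Continuous ι := continuous_const.prodMk continuous_id
  have hιd : HasFDerivAt ι ((0 : ↥K →L[ℂ] G).prod (ContinuousLinearMap.id ℂ ↥K)) 0 :=
    (hasFDerivAt_const (F a) 0).prodMk (hasFDerivAt_id 0)
  have hι0 : ι 0 = (F a, 0) := rfl
  have hconst : ∀ k, ι k ∈ T → Gf (Ψ (ι k)) = Gf a := by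
    intro k hk
    have h1 := hΨΦ (ι k) hk
    refine hfib _ (hSW h1.1) ?_
    have := congrArg Prod.fst h1.2
    simpa [hι] using this
  have hev : (fun k => Gf (Ψ (ι k))) =ᶠ[𝓝 0] fun _ => Gf a := by
    have h0 : ι 0 ∈ T := by rw [hι0]; exact h0T
    filter_upwards [hιc.continuousAt.preimage_mem_nhds (hTo.mem_nhds h0)] with k hk
    exact hconst k hk
  have hΨa : HasFDerivAt Ψ (fderiv ℂ Ψ (F a, 0)) (ι 0) := by
    rw [hι0]
    exact (hΨd.differentiableAt (hTo.mem_nhds h0T)).hasFDerivAt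
  have hGa : HasFDerivAt Gf (fderiv ℂ Gf a) (Ψ (ι 0)) := by
    rw [hι0, hΨ0]
    exact (hGf.differentiableAt (hW.mem_nhds ha)).hasFDerivAt
  have hcomp := hGa.comp 0 (hΨa.comp 0 hιd)
  have hderiv0 := hcomp.unique ((hasFDerivAt_const (Gf a) 0).congr_of_eventuallyEq hev)
  have key : ∀ k : ↥K, fderiv ℂ Gf a (fderiv ℂ Ψ (F a, 0) (0, k)) = 0 := fun k => by
    simpa using congrArg (fun L => L k) hderiv0
  -- `v = dΨ (0, ψ v)` from `Ψ ∘ Φ = id` near `a`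
  have hΦd : HasFDerivAt (fun z => (F z, ψ (z - a))) ((fderiv ℂ F a).prod ψ) a := by
    have h1 : HasFDerivAt F (fderiv ℂ F a) a :=
      (hF.differentiableAt (hW.mem_nhds ha)).hasFDerivAt
    have h2 : HasFDerivAt (fun z => ψ (z - a)) ψ a := by
      simpa only [map_sub] using ψ.hasFDerivAt.sub_const (ψ a)
    exact h1.prodMk h2
  have hΨΦa : HasFDerivAt Ψ (fderiv ℂ Ψ (F a, 0)) (F a, ψ (a - a)) := by
    rw [hψ0]
    exact (hΨd.differentiableAt (hTo.mem_nhds h0T)).hasFDerivAt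
  have hid : HasFDerivAt (fun z => Ψ (F z, ψ (z - a)))
      ((fderiv ℂ Ψ (F a, 0)).comp ((fderiv ℂ F a).prod ψ)) a := hΨΦa.comp a hΦd
  have hev' : (fun z => Ψ (F z, ψ (z - a))) =ᶠ[𝓝 a] id := by
    filter_upwards [hSo.mem_nhds haS] with z hz
    exact (hΦΨ z hz).2
  have hcompid := hid.unique ((hasFDerivAt_id a).congr_of_eventuallyEq hev')
  have hv' : fderiv ℂ Ψ (F a, 0) (0, ψ v) = v := by
    have := congrArg (fun L => L v) hcompid
    simpa [hv0] using this
  rw [← hv']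
  exact key (ψ v)

/-- **Equal fibres have differentials with equal kernels, hence targets of equal dimension.** If
`F : E → G` and `Gf : E → G'` are complex-differentiable on an open `W ∋ a` with surjective
differentials at `a` and the same fibre through `a` inside `W`, then `dim G = dim G'`.
[Chirka, *Complex Analytic Sets*, §2.3] [folklore] -/
theorem finrank_eq_of_fderiv_surjective_of_forall_iff [FiniteDimensional ℂ G'] {F : E → G}
    {Gf : E → G'} {W : Set E} (hF : DifferentiableOn ℂ F W) (hGf : DifferentiableOn ℂ Gf W)
    (hW : IsOpen W) {a : E} (ha : a ∈ W) (hFs : Function.Surjective (fderiv ℂ F a))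
    (hGs : Function.Surjective (fderiv ℂ Gf a)) (hfib : ∀ z ∈ W, F z = F a ↔ Gf z = Gf a) :
    Module.finrank ℂ G = Module.finrank ℂ G' := by
  have h1 := ker_fderiv_le_ker_fderiv_of_forall_eq hF hGf hW ha hFs fun z hz => (hfib z hz).1
  have h2 := ker_fderiv_le_ker_fderiv_of_forall_eq hGf hF hW ha hGs fun z hz => (hfib z hz).2
  have hker := le_antisymm h1 h2
  have e1 := LinearMap.finrank_range_add_finrank_ker (fderiv ℂ F a : E →ₗ[ℂ] G)
  have e2 := LinearMap.finrank_range_add_finrank_ker (fderiv ℂ Gf a : E →ₗ[ℂ] G')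
  have hr1 : LinearMap.range (fderiv ℂ F a : E →ₗ[ℂ] G) = ⊤ :=
    LinearMap.range_eq_top.2 hFs
  have hr2 : LinearMap.range (fderiv ℂ Gf a : E →ₗ[ℂ] G') = ⊤ :=
    LinearMap.range_eq_top.2 hGs
  rw [hr1, finrank_top] at e1
  rw [hr2, finrank_top] at e2
  rw [hker] at e1
  omega

end SCV

/-! ### Regular points: stability and uniqueness of the codimension -/

section Regular

variable [FiniteDimensional ℂ E] [IsManifold I 1 M] [I.Boundaryless]

/-- **Regularity of a given codimension is an open condition.** If `x` is a regular point of
codimension `p` of `Z ⊆ M`, then so is every point near `x` (with the same neighbourhood and the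
same defining map, whose differential stays surjective near `x` by the holomorphic straightening
theorem). [Chirka, *Complex Analytic Sets*, §2.3 ("reg A is open in A")] [folklore] -/
theorem IsRegularPointOfCodim.eventually {Z : Set M} {p : ℕ} {x : M}
    (h : IsRegularPointOfCodim I Z p x) : ∀ᶠ y in 𝓝 x, IsRegularPointOfCodim I Z p y := by
  obtain ⟨U, hU, hxU, f, hf, hZU, hfs⟩ := h
  set W := (extChartAt I x).target ∩ (extChartAt I x).symm ⁻¹' U with hW
  have hWo : IsOpen W := isOpen_extChartAt_target_inter_preimage_symm x hU
  have haW : extChartAt I x x ∈ W :=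
    ⟨mem_extChartAt_target x, by simpa only [mem_preimage, extChartAt_to_inv] using hxU⟩
  have hF : DifferentiableOn ℂ (f ∘ (extChartAt I x).symm) W :=
    MDifferentiableOn.differentiableOn_extChartAt_symm hf x
  have hFs : Function.Surjective (fderiv ℂ (f ∘ (extChartAt I x).symm) (extChartAt I x x)) :=
    (surjective_mfderiv_iff_extChartAt (mem_extChartAt_source x)
      (hF.differentiableAt (hWo.mem_nhds haW))).1 hfs
  obtain ⟨ψ, hbij⟩ := Literature.Analysis.Complex.SCV.exists_proj_ker_bijective _ hFs
  obtain ⟨S, T, Ψ, hSo, haS, hSW, -, -, -, -, hsurjS⟩ :=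
    Literature.Analysis.Complex.SCV.exists_straightening hF hWo haW ψ hbij
  have hN : (extChartAt I x).source ∩ extChartAt I x ⁻¹' S ∈ 𝓝 x :=
    (isOpen_extChartAt_preimage' x hSo).mem_nhds ⟨mem_extChartAt_source x, haS⟩
  filter_upwards [hN] with y hy
  have hyW : extChartAt I x y ∈ W := hSW hy.2
  have hyU : y ∈ U := by
    have := hyW.2
    simpa only [mem_preimage, (extChartAt I x).left_inv hy.1] using this
  refine ⟨U, hU, hyU, f, hf, hZU, ?_⟩
  rw [surjective_mfderiv_iff_extChartAt hy.1 (hF.differentiableAt (hWo.mem_nhds hyW))]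
  intro c
  obtain ⟨v, hv⟩ := hsurjS _ hy.2 (c, 0)
  exact ⟨v, congrArg Prod.fst hv⟩

/-- **The codimension at a regular point is well defined**: if a point `x ∈ Z` is regular of
codimension `p` and of codimension `q` for `Z`, then `p = q`. (In an extended chart at `x` the two
defining maps have the same fibre through `x`, namely the image of `Z`, so their differentials at
`x` — both surjective — have the same kernel,
`SCV.finrank_eq_of_fderiv_surjective_of_forall_iff`.) Membership `x ∈ Z` is necessary: at a
point outside `closure Z` every codimension `p ≤ dim E` occurs.
[Chirka, *Complex Analytic Sets*, §2.3 (Def. of `dim_a A` at regular points)] [folklore] -/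
theorem IsRegularPointOfCodim.codim_unique {Z : Set M} {p q : ℕ} {x : M} (hx : x ∈ Z)
    (hp : IsRegularPointOfCodim I Z p x) (hq : IsRegularPointOfCodim I Z q x) : p = q := by
  obtain ⟨U, hU, hxU, f, hf, hZU, hfs⟩ := hp
  obtain ⟨U', hU', hxU', g, hg, hZU', hgs⟩ := hq
  set W := (extChartAt I x).target ∩ (extChartAt I x).symm ⁻¹' (U ∩ U') with hW
  have hWo : IsOpen W := isOpen_extChartAt_target_inter_preimage_symm x (hU.inter hU')
  have haW : extChartAt I x x ∈ W :=
    ⟨mem_extChartAt_target x, by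
      simpa only [mem_preimage, extChartAt_to_inv] using ⟨hxU, hxU'⟩⟩
  have hF : DifferentiableOn ℂ (f ∘ (extChartAt I x).symm) W :=
    (MDifferentiableOn.differentiableOn_extChartAt_symm hf x).mono
      (inter_subset_inter_right _ (preimage_mono inter_subset_left))
  have hG : DifferentiableOn ℂ (g ∘ (extChartAt I x).symm) W :=
    (MDifferentiableOn.differentiableOn_extChartAt_symm hg x).mono
      (inter_subset_inter_right _ (preimage_mono inter_subset_right))
  have hFs : Function.Surjective (fderiv ℂ (f ∘ (extChartAt I x).symm) (extChartAt I x x)) :=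
    (surjective_mfderiv_iff_extChartAt (mem_extChartAt_source x)
      (hF.differentiableAt (hWo.mem_nhds haW))).1 hfs
  have hGs : Function.Surjective (fderiv ℂ (g ∘ (extChartAt I x).symm) (extChartAt I x x)) :=
    (surjective_mfderiv_iff_extChartAt (mem_extChartAt_source x)
      (hG.differentiableAt (hWo.mem_nhds haW))).1 hgs
  have hfx : f x = 0 := (hZU.subset ⟨hx, hxU⟩).2
  have hgx : g x = 0 := (hZU'.subset ⟨hx, hxU'⟩).2
  have hFa : (f ∘ (extChartAt I x).symm) (extChartAt I x x) = 0 := by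
    simp only [Function.comp_apply, extChartAt_to_inv, hfx]
  have hGa : (g ∘ (extChartAt I x).symm) (extChartAt I x x) = 0 := by
    simp only [Function.comp_apply, extChartAt_to_inv, hgx]
  have hfib : ∀ z ∈ W,
      (f ∘ (extChartAt I x).symm) z = (f ∘ (extChartAt I x).symm) (extChartAt I x x) ↔
        (g ∘ (extChartAt I x).symm) z = (g ∘ (extChartAt I x).symm) (extChartAt I x x) := by
    intro z hz
    rw [hFa, hGa]
    simp only [Function.comp_apply]
    have hzU : (extChartAt I x).symm z ∈ U := hz.2.1
    have hzU' : (extChartAt I x).symm z ∈ U' := hz.2.2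
    constructor
    · intro h0
      have hzZ : (extChartAt I x).symm z ∈ Z := (hZU.symm.subset ⟨hzU, h0⟩).1
      exact (hZU'.subset ⟨hzZ, hzU'⟩).2
    · intro h0
      have hzZ : (extChartAt I x).symm z ∈ Z := (hZU'.symm.subset ⟨hzU', h0⟩).1
      exact (hZU.subset ⟨hzZ, hzU⟩).2
  have := SCV.finrank_eq_of_fderiv_surjective_of_forall_iff hF hG hWo haW hFs hGs hfib
  simpa using this

/-- **Purity of the closure of a stratum of regular points.** Let `Z` be closed and let
`R = {x ∈ Z | x regular of codimension p}` be nonempty. If the closure `W = closure R` is an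
analytic subset of `M`, then `W` has pure codimension `p`: at a regular point `x` of `W`, of some
codimension `q`, regularity of codimension `q` propagates to nearby points of `W`
(`IsRegularPointOfCodim.eventually`), among which there is a point `y ∈ R`; near `y` the sets `W`
and `Z` agree and `y` is regular of codimension `p` for `W` as well, whence `p = q`
(`IsRegularPointOfCodim.codim_unique`). This is the (elementary) purity half of
[Chirka1989, §5.2 Thm. 1]; the analyticity of `W` is the deep half.
[Chirka, *Complex Analytic Sets*, §2.4 and §5.2 Thm. 1] [folklore] -/
theorem hasPureCodim_closure_of_isAnalyticSet_closure {Z : Set M} (hZ : IsClosed Z) {p : ℕ}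
    (hne : {x ∈ Z | IsRegularPointOfCodim I Z p x}.Nonempty)
    (han : IsAnalyticSet I (closure {x ∈ Z | IsRegularPointOfCodim I Z p x})) :
    HasPureCodim I (closure {x ∈ Z | IsRegularPointOfCodim I Z p x}) p := by
  set W := closure {x ∈ Z | IsRegularPointOfCodim I Z p x} with hW
  have hWZ : W ⊆ Z := closure_minimal (sep_subset Z _) hZ
  refine ⟨han, hne.mono subset_closure, fun x hxreg => ?_⟩
  obtain ⟨hxW, q, hq⟩ := hxreg
  suffices hpq : p = q by rwa [hpq]
  -- a point `y ∈ R` near `x` at which `W` is regular of codimension `q`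
  obtain ⟨y, hyq, hyZ, hyp⟩ :
      ∃ y, IsRegularPointOfCodim I W q y ∧ y ∈ Z ∧ IsRegularPointOfCodim I Z p y := by
    obtain ⟨y, hy⟩ := mem_closure_iff_nhds.1 hxW _ hq.eventually
    exact ⟨y, hy.1, hy.2.1, hy.2.2⟩
  -- `y` is regular of codimension `p` for `W`: near `y`, `W` and `Z` coincide
  have hypW : IsRegularPointOfCodim I W p y := by
    obtain ⟨U₃, hU₃, hU₃o, hyU₃⟩ := mem_nhds_iff.1 hyp.eventually
    obtain ⟨U, hU, hyU, f, hf, hZU, hfs⟩ := hyp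
    refine ⟨U ∩ U₃, hU.inter hU₃o, ⟨hyU, hyU₃⟩, f, hf.mono inter_subset_left, ?_,
      hfs⟩
    ext y'
    constructor
    · rintro ⟨hy'W, hy'U, hy'U₃⟩
      exact ⟨⟨hy'U, hy'U₃⟩, (hZU.subset ⟨hWZ hy'W, hy'U⟩).2⟩
    · rintro ⟨⟨hy'U, hy'U₃⟩, h0⟩
      have hy'Z : y' ∈ Z := (hZU.symm.subset ⟨hy'U, h0⟩).1
      exact ⟨subset_closure ⟨hy'Z, hU₃ hy'U₃⟩, hy'U, hy'U₃⟩
  have hyW : y ∈ W :=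
    subset_closure (show y ∈ {x ∈ Z | IsRegularPointOfCodim I Z p x} from ⟨hyZ, hyp⟩)
  exact hypW.codim_unique hyW hyq

end Regular

end Literature.Geometry.Kaehler
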